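import Literature.MathematicalPhysics.QuantumFieldTheory.Balaban1983to89.B8Ineq198MultiLevelTorusP22L0
import Literature.MathematicalPhysics.QuantumFieldTheory.Balaban1983to89.B6Prop23MultiLevelTorusL0

/-!
# `Balaban1983to89.B8Ineq198MultiLevelTorusP23L0` — LEVEL-0 TWIN (programme G-F3′-L0's dictionary; UV3-NODE (P2-L3) ∕ P1♭ `core` junction J-N05♭, J1 of LEAD-H ★w5-19200 g4's
T2♭-PLAN v1.1, RULING L-2 (2)) of `B8Ineq198MultiLevelTorusP23`: the SAME declarations (`ineq198R_multiLevelTorus_P23`, `ineq1101_GR_multiLevelTorus_P23`, `ineq198R_multiLevelTorus_msup_P23`), SAME NAMES, for lit-balaban's LEVEL-0-ADMITTING torus families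
`B6MultiLevelTorusOperatorL0.TDomains` (blocks of every level `0 ≤ j ≤ k`, print p.225 (2.14) «Σ_{j=0}^k … (Q′₀λ)(x) = λ(x), x ∈ Λ₀» — the families the H-side P2 port
`FlatPort*L0∕AllL` reads), obtained by the dictionary swap `…MultiLevelTorus ↦ …MultiLevelTorusL0` of every parent (all ✓ in the tree; the L0 Prop.-2.2∕2.3 suppliers' weight
windows quantify over EVERY level `i` incl. `0`, so the level-`≥ 1` window binders of the originals lose their `1 ≤ i` guard).  Unit `ym-inputs-p09` (cell `pub/ym-inputs`,
H-side hand of cell `ym3-torus`), 2026-08-28.  No `def`, no new fact, standard axioms; every input BY NAME.  NOT summit progress; rung R3 bookkeeping, not Clay.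
THE TWIN'S DOCUMENTATION FOLLOWS VERBATIM.

# `Balaban1983to89.B8Ineq198MultiLevelTorusP23` — T. Bałaban, *Spaces of regular gauge field configurations on a lattice and gauge
# fixing conditions*, Commun. Math. Phys. **99** (1985) 75–102 [Balaban1985RegularSpaces], p. 92 **(1.98) R-half** «|Rf|₍₋₂₎ ≦ B′₀|f|₍₋₂₎»
# and the composite letter **`G′R` of (1.100)–(1.101)** p. 93 **AT U₀ = 1 ON PRINT'S CARRIER — THE GENUINE `k`-LEVEL NESTED-DOMAIN TORUS
# FAMILY `T_η = Ω₁ ⊃ … ⊃ Ω_k` — HYPOTHESIS-FREE**: the last argument `G` of `B8Ineq198MultiLevelTorusP22` instantiated with THE inverse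
# `(Q′G′²Q′*)⁻¹ = GinvT D a` of [B6] Proposition 2.3 for this family (`B6Prop23MultiLevelTorus.prop23_multiLevelTorus`, seat p21 gen 16,
# p350221, 2026-08-23T02:58Z)

statement-level skeleton of published theorems with citation tags; proofs where landed; nothing here is a claim about the Yang–Mills mass gap

CITATION HEADER (lean-in-tree rule).  Cell `lit-balaban`, unit `lit-balaban-r05` gen 59 (B8 reader/typer and fold owner; the announced
successor step of `B8Ineq198MultiLevelTorus` p344001 / `B8Ineq198MultiLevelTorusP22` p344806, HOME/lit-balaban-r05/HANDOFF.md § gen 54–58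
trigger (iii-c)).  WHAT IS REPRODUCED = SKELETON rows **B8.Eq1.99** (member (1.98), R-half) and **B8.Eq1.101** (the composite `G′R` of
(1.100)–(1.101)) at the flat background ON PRINT'S OWN CARRIER `T_η`, NOW WITH NO HYPOTHESIS: `B8Ineq198MultiLevelTorusP22` proved
«|Rf|₍₋ₙ₎ ≦ B′₀|f|₍₋ₙ₎» (pointwise and in print's p. 86 norm `|·|₍α₎`) and the `G′R` bounds for EVERY operator `G` on `𝔅` carrying the
printed (2.87)-bound of `(Q′G′²Q′*)⁻¹`, the [B6] Prop.-2.2 torus entries already discharged there by p21's T4–T7; p21's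
`B6Prop23MultiLevelTorus.prop23_multiLevelTorus` (G2 of the torus `(Q′G′²Q′*)⁻¹` programme) now supplies THE operator `GinvT D a` (a
definition with a body) with `GinvT·(Q′G′²Q′*) = 1`, `(Q′G′²Q′*)·GinvT = 1` and (2.87) in exactly the letters consumed.  This file is the
three-line composition for print's own `R = 1 − G′Q′*(Q′G′²Q′*)⁻¹Q′G′` (`rProjMLT D a (GinvT D a)`) and `P = 1 − R` (`pProjMLT D a (GinvT D a)`):
(1.98) R-half for every exponent `n` (pointwise and in `|·|₍₋ₙ₎`) and the `G′R` letter of (1.100)–(1.101), constants depending on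
`d, ℓ`, the windows (and `n`) only.  ((1.101) itself — the four `G′` bounds — is already hypothesis-free in
`B8Ineq198MultiLevelTorusP22.ineq1101_multiLevelTorus(_two/_msup)_P22`: no inverse enters there.)  Kind «kernel-checked proof of a model
instance»; theorems only; every input BY NAME; 0 sorry; no fact minted.

WHAT IS PRINTED (verbatim, held text `paper:balaban1985-cmp99-regular-spaces-gauge-fixing`).  p. 92 [p0018 L16–17]: *"Let us recall
that from Theorems 3.1, 3.2 of [4] it follows that |Rf| ≦ B′₀|f|"*; p. 92 [p0018 L35–37]: *"The operators R and V are bounded in this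
norm, and we have |Rf|₍₋₂₎ ≦ B′₀|f|₍₋₂₎, |Vf|₍₋₂₎ ≦ O(α₄)|f|₍₋₂₎. (1.98) Thus it is a function with a bounded norm |·|₍₋₂₎."*;
p. 93 [p0019 L17–19]: *"One of the results of [4], Theorem 3.1, tells us that G′ is a bounded operator from a space with the norm
|·|₍₋₂₎ into a space with the norm |·| for functions, and the norm |·|₍₋₁₎ for their first derivatives."*, (1.100) «λ = G′RD\*A + G′R𝔉₄(λ, Dλ, A, D\*A)»; p. 86 (the norms `|·|₍α₎` after (1.55)).  [4] CMP **99**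
[Balaban1985BackgroundPropagators] (3.25) p. 394, (3.47) p. 398, (3.49) p. 399; [B6] CMP **96** [Balaban1984PropagatorsII] Prop. 2.3
(2.87) p. 238 [p0016 L13–18], p. 235 [p0013 L19–20] «Of course the operator Q′G′²Q′\* is positive definite, so its inverse is well
defined», Prop. 2.2 (2.67) p. 234, p. 224 «we admit the case when some domains Ω_j are equal to T_η».

HONEST SCOPE / NOT CLAIMED.  As `B8Ineq198MultiLevelTorus(P22)`: print's carrier `T_η` with `Ω₁ = T_η` (levels `1 … k`), `A = 0`
(U₀ = 1), scalar fibre, lattice units (η = 1), `∇_μ = dT N₀ μ`, the weight `(L^{j(z)})⁻ⁿ` read at each point's own level,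
`|·|₍α₎ = B8ScaledSupNorm.msup (ℓ+1) k 1 α (Ω_j = {z : j ≤ lev z})`; constants existential (functions of `d, ℓ`, the windows, `n`);
thresholds «M, RM sufficiently large» explicit (`M_h ≥ 3`, `L·M_h ≥ M₀`, `R ≥ 2L`, `R·L·M_h ≥ N₀ + 1`, periods `P_μ ≥ 4`).  The H′-half
of (1.98) on `T_η` is `B8Ineq192MultiLevelTorusP23.ineq192_multiLevelTorus_P23` (companion file); the general (1.98)/(1.99) at a
background `U₀ ∈ 𝔄_k` ([4] Thms 3.1–3.3) stays the typed leaf of `B8Ineq198R` / `B8Ineq192Op`; rows B8.Eq1.99 / B8.Eq1.101 /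
B8.Claim@92 heads NOT changed (owner's word).  NOT summit progress, NOT continuum, NOT Clay.
-/

namespace Literature.MathematicalPhysics.QuantumFieldTheory.Balaban1983to89.B8Ineq198MultiLevelTorusP23L0

open Finset Matrix
open B4Reflection242 (boxDom)
open B6MultiLevelBoxOperator hiding Domains mlOp_apply
open B6MultiLevelBoxOperatorL0
open B6MultiLevelTorusOperator hiding TDomains mlOpT_apply mlOpT_eq_reindex_chart mlOpT_mul_reindex mlOpT_tshift
open B6MultiLevelTorusOperatorL0
open B6Geom246MultiLevelBox hiding Touch blkOf blkOf_corner blkOf_eq_iff_blk blkOf_eq_of_blk_i_eq blkOf_val bond bond_adj bset cen connected coord_bounds corner corner_mem csys dist_blkOf_le_box dist_blkOf_le_coord dist_blkOf_le_line dist_cen_le_of_adj dist_cen_le_of_touch dist_le_one_of_near dist_toR_cen_le exists_blkOf_eq geom lemma21_box lev_corner lev_eq_of_blkOf_eq levelGap pack reachable_blkOf reachable_of_near realizes scale_bounds touch_symm triangle_refl_nonneg walk_disp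
open B6Geom246MultiLevelBoxL0
open B6Geom246MultiLevelTorus hiding TouchT blkHom blkMap blkMap_blkOf blkMap_injective blkMap_surjective blkOf_tshift_eq bondT bondT_adj bond_le_bondT connectedT csysT distT_le_dist_box distT_le_dist_chart dist_posT_le_of_adj dist_posT_le_of_touchT dist_site_posT_le geomT label_bounds lemma21_torus levelGapT packT posT realizesT touchT_symm triangle_refl_nonneg_T walk_dispT
open B6Geom246MultiLevelTorusL0
open B6Ineq268MultiLevelBox hiding QB QB_apply QsB QsB_apply W W_eq W_pos Xk abs_qB abs_qB_le card_blkOf_le csysB geomB geomB_L geomB_M geomB_R geomB_RM geomB_RM_nonneg geomB_Site geomB_dist geomB_eta geomB_len geom_len ineq268_multiLevelBox instDecidableEqGeomBSite kerOp_Xk levelSepB qB qB_ne_zero realizesB refl_nonnegB sum_abs_qB_le symmB triangleB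
open B6Ineq268MultiLevelBoxL0
open B6RandomWalk (HasMajorant BlockSupp hasMajorant_mono)
open B6Ineq261LevelGap (K261 K261_nonneg theta_lt_one_of_log)
open B6Expansion282 (kerOp)
open B6Prop23Chain (mat)
open B8Ineq192MultiLevelBox (abs_apply_le_of_levelBound levelRowSum_le ineq261With_of_le)
open B8Ineq192MultiLevelTorusL0
open B9Ineq349MultiLevelTorusL0 (pProjMLT rProjMLT_eq_one_sub_pProjMLT ineq349_multiLevelTorus)
open B6Ineq243TwoLevelBox (aNext)
open B6Prop22DerivMultiLevelTorus (dT)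
open B6Prop23MultiLevelTorusL0 (GinvT prop23_multiLevelTorus)
open B8ScaledSupNorm (msup)
open B8Ineq198MultiLevelTorusP22L0 (ineq198R_multiLevelTorus_P22 ineq1101_GR_multiLevelTorus_P22 ineq198R_multiLevelTorus_msup_P22)

noncomputable section

variable {d : ℕ}

/-- **(1.98), R-HALF, AT U₀ = 1 ON PRINT'S CARRIER `T_η` — HYPOTHESIS-FREE** («|Rf|₍₋₂₎ ≦ B′₀|f|₍₋₂₎», here every exponent `n`), for
print's own `R = 1 − G′Q′*(Q′G′²Q′*)⁻¹Q′G′` (`rProjMLT D a (GinvT D a)`) and `P = 1 − R` (`pProjMLT D a (GinvT D a)`), THE inverse of [B6]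
Prop. 2.3 inside: for every `n` there are `B′₀, M₀ > 0`, `N₀ ≥ 1` (functions of `d, ℓ`, the windows, `n`) such that for every member of
the torus family in print's regime (`M_h ≥ 3`, `L·M_h ≥ M₀`, `R ≥ 2L`, `R·L·M_h ≥ N₀ + 1`, `P_μ ≥ 4`, windowed weights with the
recursion), `GinvT·(Q′G′²Q′*) = 1 = (Q′G′²Q′*)·GinvT` and, for every `f` with `|f(z)| ≦ S(L^{j(z)})⁻ⁿ` and every point `x`:
`|(Pf)(x)| ≦ B′₀(L^{j(x)})⁻ⁿS` and **`|(Rf)(x)| ≦ B′₀(L^{j(x)})⁻ⁿS`** — `B8Ineq198MultiLevelTorusP22.ineq198R_multiLevelTorus_P22` ∘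
`prop23_multiLevelTorus`. [cite: Balaban1985RegularSpaces, (1.98) p.92, (1.27) p.80; Balaban1985BackgroundPropagators, (3.49) p.399, (3.47) p.398, (3.25) p.394; Balaban1984PropagatorsII, Prop. 2.3 (2.87) p.238, Prop. 2.2 (2.67) p.234, p.235, p.224 (Ω₁ = T_η admitted)] -/
theorem ineq198R_multiLevelTorus_P23 (d ℓ : ℕ) (hℓ : 1 ≤ ℓ) (aminus aplus a2minus a2plus : ℝ) (ha : 0 < aminus)
    (ha2 : 0 < a2minus) (n : ℕ) :
    ∃ B₀' M₀ : ℝ, ∃ N₀ : ℕ, 0 < B₀' ∧ 0 < M₀ ∧ 0 < N₀ ∧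
      ∀ (k Mh R : ℕ), 3 ≤ Mh → M₀ ≤ ((ℓ : ℝ) + 1) * Mh → 2 * (ℓ + 1) ≤ R → N₀ + 1 ≤ R * ((ℓ + 1) * Mh) →
      ∀ (P : Fin (d + 1) → ℕ) (_hP : ∀ μ, 1 ≤ P μ) (_hP4 : ∀ μ, 4 ≤ P μ) (D : B6MultiLevelTorusOperatorL0.TDomains d ℓ Mh k P R) (a c : ℕ → ℝ),
        (∀ i, aminus ≤ a i ∧ a i ≤ aplus) → (∀ i, a2minus ≤ c i ∧ c i ≤ a2plus) →
        (∀ i, a (i + 1) = aNext ℓ (a i) (c i)) →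
        GinvT D a * kerOp (W D.toDomains) (XkT D a) = 1 ∧ kerOp (W D.toDomains) (XkT D a) * GinvT D a = 1 ∧
        ∀ (f : ↥(boxDom (N0 ℓ Mh k P)) → ℝ) (S : ℝ), 0 ≤ S →
          (∀ z : ↥(boxDom (N0 ℓ Mh k P)), |f z| ≤ S * ((((ℓ : ℝ) + 1) ^ D.lev z.1) ^ n)⁻¹) →
          ∀ x : ↥(boxDom (N0 ℓ Mh k P)),
            |pProjMLT D a (GinvT D a) f x| ≤ B₀' * ((((ℓ : ℝ) + 1) ^ D.lev x.1) ^ n)⁻¹ * S ∧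
            |rProjMLT D a (GinvT D a) f x| ≤ B₀' * ((((ℓ : ℝ) + 1) ^ D.lev x.1) ^ n)⁻¹ * S := by
  obtain ⟨δ₁, C₁, M₁, hδ₁, hC₁, hM₁, hP23⟩ := prop23_multiLevelTorus d ℓ hℓ aminus aplus a2minus a2plus ha ha2
  obtain ⟨B₀', M₀, N₀, hB, hM₀, hN₀, h⟩ :=
    ineq198R_multiLevelTorus_P22 d ℓ hℓ aminus aplus a2minus a2plus ha ha2 hC₁ hδ₁ n
  refine ⟨B₀', max M₀ M₁, N₀, hB, lt_max_of_lt_left hM₀, hN₀, ?_⟩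
  intro k Mh R hMh hM hRL hRM P hP hP4 D a c haw hcw hac
  obtain ⟨h1, h2, -, hG⟩ := hP23 k Mh R ((le_max_right _ _).trans hM) hRL P hP hP4 D a c haw hcw hac
  exact ⟨h1, h2, h k Mh R hMh ((le_max_left _ _).trans hM) hRL hRM P hP hP4 D a c haw hcw hac (GinvT D a) hG⟩

/-- **THE COMPOSITE LETTER `G′R` OF (1.100)–(1.101) AT U₀ = 1 ON PRINT'S CARRIER `T_η` — HYPOTHESIS-FREE** («λ = G′RD\*A +
G′R𝔉₄(λ, Dλ, A, D\*A) … |G′R𝔉|, |DG′R𝔉|₍₋₁₎ ≦ O(1)B′₀ξ₁(…) on Ω_j»), for print's own `R = rProjMLT D a (GinvT D a)` and the GENUINE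
`G′ = gmlT`, `∇_μ = dT N₀ μ`: there are `C″, M₀ > 0`, `N₀ ≥ 1` such that for every member of the family in print's regime, every `f` with
`|f(z)| ≦ S(L^{j(z)})⁻²` and every point `x` at its level `j`: `|(G′Rf)(x)| ≦ C″S` and `|(∇_μG′Rf)(x)| ≦ C″(Lʲ)⁻¹S` (every axis) —
`B8Ineq198MultiLevelTorusP22.ineq1101_GR_multiLevelTorus_P22` ∘ `prop23_multiLevelTorus`.
[cite: Balaban1985RegularSpaces, (1.100)–(1.101) p.93, (1.98) p.92; Balaban1985BackgroundPropagators, Theorem 3.1 p.397, (3.47) p.398, (3.49) p.399, (3.25) p.394; Balaban1984PropagatorsII, Prop. 2.3 (2.87) p.238, Prop. 2.2 (2.67) p.234, p.224] -/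
theorem ineq1101_GR_multiLevelTorus_P23 (d ℓ : ℕ) (hℓ : 1 ≤ ℓ) (aminus aplus a2minus a2plus : ℝ) (ha : 0 < aminus)
    (ha2 : 0 < a2minus) :
    ∃ C'' M₀ : ℝ, ∃ N₀ : ℕ, 0 < C'' ∧ 0 < M₀ ∧ 0 < N₀ ∧
      ∀ (k Mh R : ℕ), 3 ≤ Mh → M₀ ≤ ((ℓ : ℝ) + 1) * Mh → 2 * (ℓ + 1) ≤ R → N₀ + 1 ≤ R * ((ℓ + 1) * Mh) →
      ∀ (P : Fin (d + 1) → ℕ) (_hP : ∀ μ, 1 ≤ P μ) (_hP4 : ∀ μ, 4 ≤ P μ) (D : B6MultiLevelTorusOperatorL0.TDomains d ℓ Mh k P R) (a c : ℕ → ℝ),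
        (∀ i, aminus ≤ a i ∧ a i ≤ aplus) → (∀ i, a2minus ≤ c i ∧ c i ≤ a2plus) →
        (∀ i, a (i + 1) = aNext ℓ (a i) (c i)) →
        GinvT D a * kerOp (W D.toDomains) (XkT D a) = 1 ∧ kerOp (W D.toDomains) (XkT D a) * GinvT D a = 1 ∧
        ∀ (f : ↥(boxDom (N0 ℓ Mh k P)) → ℝ) (S : ℝ), 0 ≤ S →
          (∀ z : ↥(boxDom (N0 ℓ Mh k P)), |f z| ≤ S * ((((ℓ : ℝ) + 1) ^ D.lev z.1) ^ 2)⁻¹) →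
          ∀ x : ↥(boxDom (N0 ℓ Mh k P)),
            |(gmlT (N0 ℓ Mh k P) ℓ k D.lev a *ᵥ rProjMLT D a (GinvT D a) f) x| ≤ C'' * S ∧
            ∀ μ : Fin (d + 1),
              |(dT (N0 ℓ Mh k P) μ *ᵥ (gmlT (N0 ℓ Mh k P) ℓ k D.lev a *ᵥ rProjMLT D a (GinvT D a) f)) x| ≤
                C'' * (((ℓ : ℝ) + 1) ^ D.lev x.1)⁻¹ * S := by
  obtain ⟨δ₁, C₁, M₁, hδ₁, hC₁, hM₁, hP23⟩ := prop23_multiLevelTorus d ℓ hℓ aminus aplus a2minus a2plus ha ha2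
  obtain ⟨C'', M₀, N₀, hC'', hM₀, hN₀, h⟩ :=
    ineq1101_GR_multiLevelTorus_P22 d ℓ hℓ aminus aplus a2minus a2plus ha ha2 hC₁ hδ₁
  refine ⟨C'', max M₀ M₁, N₀, hC'', lt_max_of_lt_left hM₀, hN₀, ?_⟩
  intro k Mh R hMh hM hRL hRM P hP hP4 D a c haw hcw hac
  obtain ⟨h1, h2, -, hG⟩ := hP23 k Mh R ((le_max_right _ _).trans hM) hRL P hP hP4 D a c haw hcw hac
  exact ⟨h1, h2, h k Mh R hMh ((le_max_left _ _).trans hM) hRL hRM P hP hP4 D a c haw hcw hac (GinvT D a) hG⟩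

/-- **(1.98), R-HALF, IN PRINT'S OWN NORM `|·|₍α₎` OF p. 86 ON `T_η` — HYPOTHESIS-FREE: «|Rf|₍₋ₙ₎ ≦ B′₀|f|₍₋ₙ₎»** (and `|Pf|₍₋ₙ₎ ≦
B′₀|f|₍₋ₙ₎`), `|·|₍α₎ = B8ScaledSupNorm.msup (ℓ+1) k 1 α (Ω_j = {z : j ≤ lev z})`, for print's own `R = rProjMLT D a (GinvT D a)` and `P =
pProjMLT D a (GinvT D a)` on every member of the torus family in print's regime — `B8Ineq198MultiLevelTorusP22.ineq198R_multiLevelTorus_msup_P22`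
∘ `prop23_multiLevelTorus`. [cite: Balaban1985RegularSpaces, (1.98) p.92, p.86 (definition after (1.55)); Balaban1985BackgroundPropagators, (3.41) p.397, (3.49) p.399, (3.25) p.394; Balaban1984PropagatorsII, Prop. 2.3 (2.87) p.238, Prop. 2.2 (2.67) p.234, p.224] -/
theorem ineq198R_multiLevelTorus_msup_P23 (d ℓ : ℕ) (hℓ : 1 ≤ ℓ) (aminus aplus a2minus a2plus : ℝ) (ha : 0 < aminus)
    (ha2 : 0 < a2minus) (n : ℕ) :
    ∃ B₀' M₀ : ℝ, ∃ N₀ : ℕ, 0 < B₀' ∧ 0 < M₀ ∧ 0 < N₀ ∧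
      ∀ (k Mh R : ℕ), 3 ≤ Mh → M₀ ≤ ((ℓ : ℝ) + 1) * Mh → 2 * (ℓ + 1) ≤ R → N₀ + 1 ≤ R * ((ℓ + 1) * Mh) →
      ∀ (P : Fin (d + 1) → ℕ) (_hP : ∀ μ, 1 ≤ P μ) (_hP4 : ∀ μ, 4 ≤ P μ) (D : B6MultiLevelTorusOperatorL0.TDomains d ℓ Mh k P R) (a c : ℕ → ℝ),
        (∀ i, aminus ≤ a i ∧ a i ≤ aplus) → (∀ i, a2minus ≤ c i ∧ c i ≤ a2plus) →
        (∀ i, a (i + 1) = aNext ℓ (a i) (c i)) →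
        GinvT D a * kerOp (W D.toDomains) (XkT D a) = 1 ∧ kerOp (W D.toDomains) (XkT D a) * GinvT D a = 1 ∧
        ∀ f : ↥(boxDom (N0 ℓ Mh k P)) → ℝ,
          msup (ℓ + 1) k 1 (-(n : ℝ)) (fun j (z : ↥(boxDom (N0 ℓ Mh k P))) => j ≤ D.lev z.1)
              (rProjMLT D a (GinvT D a) f) ≤
            B₀' * msup (ℓ + 1) k 1 (-(n : ℝ)) (fun j (z : ↥(boxDom (N0 ℓ Mh k P))) => j ≤ D.lev z.1) f ∧
          msup (ℓ + 1) k 1 (-(n : ℝ)) (fun j (z : ↥(boxDom (N0 ℓ Mh k P))) => j ≤ D.lev z.1)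
              (pProjMLT D a (GinvT D a) f) ≤
            B₀' * msup (ℓ + 1) k 1 (-(n : ℝ)) (fun j (z : ↥(boxDom (N0 ℓ Mh k P))) => j ≤ D.lev z.1) f := by
  obtain ⟨δ₁, C₁, M₁, hδ₁, hC₁, hM₁, hP23⟩ := prop23_multiLevelTorus d ℓ hℓ aminus aplus a2minus a2plus ha ha2
  obtain ⟨B₀', M₀, N₀, hB, hM₀, hN₀, h⟩ :=
    ineq198R_multiLevelTorus_msup_P22 d ℓ hℓ aminus aplus a2minus a2plus ha ha2 hC₁ hδ₁ n
  refine ⟨B₀', max M₀ M₁, N₀, hB, lt_max_of_lt_left hM₀, hN₀, ?_⟩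
  intro k Mh R hMh hM hRL hRM P hP hP4 D a c haw hcw hac
  obtain ⟨h1, h2, -, hG⟩ := hP23 k Mh R ((le_max_right _ _).trans hM) hRL P hP hP4 D a c haw hcw hac
  exact ⟨h1, h2, h k Mh R hMh ((le_max_left _ _).trans hM) hRL hRM P hP hP4 D a c haw hcw hac (GinvT D a) hG⟩

end

end Literature.MathematicalPhysics.QuantumFieldTheory.Balaban1983to89.B8Ineq198MultiLevelTorusP23L0
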